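import Summits.ABC.IUTFork.Joshi.FundamentalEstimateBL

/-!
# [J-III] §7.3, the local step of Thm. 7.3.1 at the standard point — DERIVED from the printed norm values; flag (F-a) settled

Companion of `Joshi/FundamentalEstimateBL.lean` (p428437; abc-iut cell block E, rung LADDER-ABC:A2.E, seat abc-iut-E-t12, slot T-12
/ plan/E/OBJECTS.tsv O-024, node J3:Thm7.3.1). SOURCE: K. Joshi, arXiv:2401.13508**v4** (unrefereed; bib `Joshi2024ATS3`), proof of
Thm. 7.3.1, PDF p.56 l.22–61, together with the one-prime computation it invokes, [J-IIp] = arXiv:2303.01662v3 (bib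
`Joshi2023ATS2Local`), proof of Thm. 9.2.1, p.27 l.5 – p.28 l.50 (render `HOME/lit/renders/Joshi-arxiv-2303.01662/`). Object-side
file (E-PLAN R14: imports only the Joshi object file; no decl of OUR side is bound).

WHAT THIS FILE DOES. In `FundamentalEstimateBL.lean` the load-bearing step of Thm. 7.3.1 is the hypothesis
`LocalThetaEstimateAt ρ` — print asserts it "by the method of proof of [Joshi, 2023b, Theorem 9.2.1] … for `ℓ ≫ 0`" (p.56
l.45–61). Here that step is SPLIT into (i) the printed NORM VALUES of the distinguished element at the standard point
(`StandardPointNorms`, a claim-`Prop`: at `w ∈ 𝕍^{odd,ss}` the `j`-th coordinate of `Ξ^α_{0,z_Θ,w}` is the Teichmüller lift of the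
Tate parameter computed in `K_{y′_{w,j}}`, of norm `|q_w^{1/2ℓ}|_{ℂ_{p_w}}^{j²/ℓ*²}` — p.56 l.29–37 with [J-IIp] (9.2.3) `v_{K_j}(p) =
(j²/ℓ*²)·v_{ℂ_p}(p)`, Prop. 7.4.2 `|[x]|_ρ = |ξ|_{K_y}`, Thm. 6.9.1 valuation scaling, normalised at `j = ℓ*`: `K_{y_{ℓ*}} = ℂ_p`) and
(ii) the ARITHMETIC, which the kernel discharges: `∏_{j=1}^{ℓ*} c^{j²/ℓ*²} > c^{ℓ*}` for `0 < c < 1` as soon as `ℓ* ≥ 2`, i.e. `ℓ ≥ 5` —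
termwise `c^{j²/ℓ*²} ≥ c` (exponent `≤ 1`) with strict inequality at `j = 1` (`localThetaEstimateAt_of_standardPointNorms`).
CONSEQUENCE for faithfulness flag (F-a) of `FundamentalEstimateBL.lean` ("the statement has no `ℓ ≫ 0`, the proof's local step
does"): over the printed norm values NO largeness of `ℓ` beyond §3.3 (11) `ℓ ≥ 5` is needed — the kernel confirms the STATEMENT's
hypothesis set, and the proof's "for `ℓ ≫ 0`" is slack inherited from [J-IIp]'s cruder exponent count ((1+1/ℓ*)/12 < ℓ*/(2ℓ),
p.28 l.12–38; E-t3's `joshi_exponent_lt`: iff `ℓ* ≥ 2`). Recorded for the referee lanes; no side taken.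

FRAMING (binding): typed ≠ proved; typed AS A CANDIDATE ≠ endorsed; nothing here bears on abc or takes a side on [IUTchIII]
Cor. 3.12, on Joshi's claims or on Mochizuki's 2024 report. `StandardPointNorms` is a HYPOTHESIS (the composite of printed
assertions listed above; the §6 carriers that would supply it are slots T-08/T-10/T-11 and E-t3's `ThetaLocusPrototype.lean` —
merge-debt); everything else is DERIVED.
-/

noncomputable section

open Set Finset

namespace Summit.ABC.IUTFork.Joshi.ATS3

namespace AdelicThetaDatum

variable (D : AdelicThetaDatum)

/-- The printed exponent of the `j`-th coordinate at the standard point: `(1/2ℓ) · (j²/ℓ*²)` for the label `j = i + 1`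
([J-III] p.56 l.29–37; [J-IIp] (9.2.3) p.27: `|ξ|_{K_j} = |ξ|_{ℂ_p}^{j²/ℓ*²}`, `|ξ_1|_{ℂ_p} = |q^{1/2ℓ}|_{ℂ_p}`).
[claim: Joshi2024ATS3, status: disputed] -/
def stdExponent (i : Fin D.lstar) : ℝ := (1 / (2 * (D.ell : ℝ))) * ((((i : ℕ) : ℝ) + 1) ^ 2 / ((D.lstar : ℝ) ^ 2))

/-- **The printed norm values at the standard point** (HYPOTHESIS; composite of [J-III] proof of Thm. 7.3.1, p.56 l.22–45:
"`z = z_Θ = (y′_{w,1}, …, y′_{w,ℓ*})_w` … `α_w` is an `ℓ*`-tuple of Teichmüller lifts of the tuple `(q_{w,j})_{j=1,…,ℓ*}` consisting of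
the Tate parameters … computed in the `ℓ*`-tuple of residue fields `(K_{y_{w,j}})_j`", with [J-IIp] Prop. 7.4.2 p.21 l.12–31
(`|[x]|_ρ = |x|_F = |ξ|_{K_y}`, independent of `ρ`) and the valuation scaling [J-IIp] Thm. 6.9.1 / (9.2.3) normalised at the
canonical point (`K_{y_{ℓ*}} = ℂ_p`)): for `w ∈ 𝕍^{odd,ss}`, `ρ ∈ (0,1]` and `j = 1, …, ℓ*`,
`|Ξ^{α_w}_{0,z_Θ,w,j}|_{B_{L′_w},ρ} = |q_w|_{ℂ_{p_w}}^{(1/2ℓ)·(j²/ℓ*²)}`. Never asserted. -/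
@[claim "Joshi2024ATS3" "disputed"]
def StandardPointNorms : Prop :=
  ∀ w ∈ D.Vss, ∀ ρ ∈ Set.Ioc (0 : ℝ) 1, ∀ i : Fin D.lstar, D.nrm w ρ (D.Xi D.std w i) = D.qAbs w ^ D.stdExponent i

/-- `0 < 1/(2ℓ)`. [folklore] -/
theorem baseExponent_pos : 0 < 1 / (2 * (D.ell : ℝ)) := by
  have := D.ell_pos; positivity

/-- The printed exponents are at most `1/(2ℓ)`: `j²/ℓ*² ≤ 1` for `j ≤ ℓ*` ([J-IIp] p.27: "exponents `≤ 1`"). [folklore] -/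
theorem stdExponent_le (i : Fin D.lstar) : D.stdExponent i ≤ 1 / (2 * (D.ell : ℝ)) := by
  unfold stdExponent
  have hl : (0 : ℝ) < (D.lstar : ℝ) ^ 2 := by
    have := D.two_le_lstar; positivity
  have hj : ((((i : ℕ) : ℝ) + 1) ^ 2) ≤ (D.lstar : ℝ) ^ 2 := by
    have h1 : (((i : ℕ) : ℝ) + 1) ≤ (D.lstar : ℝ) := by exact_mod_cast Nat.succ_le_of_lt i.isLt
    have h0 : (0 : ℝ) ≤ ((i : ℕ) : ℝ) + 1 := by positivity
    nlinarith
  have hr : ((((i : ℕ) : ℝ) + 1) ^ 2 / (D.lstar : ℝ) ^ 2) ≤ 1 := by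
    rw [div_le_one hl]; exact hj
  calc (1 / (2 * (D.ell : ℝ))) * ((((i : ℕ) : ℝ) + 1) ^ 2 / (D.lstar : ℝ) ^ 2)
      ≤ (1 / (2 * (D.ell : ℝ))) * 1 := mul_le_mul_of_nonneg_left hr D.baseExponent_pos.le
    _ = 1 / (2 * (D.ell : ℝ)) := mul_one _

/-- At the first label (`j = 1`, which exists since `ℓ* ≥ 2`) the exponent is STRICTLY below `1/(2ℓ)`: `1/ℓ*² < 1`. This is the
only place `ℓ* ≥ 2` (i.e. `ℓ ≥ 5`, §3.3 (11)) enters. [folklore] -/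
theorem stdExponent_zero_lt : D.stdExponent ⟨0, lt_of_lt_of_le (by norm_num) D.two_le_lstar⟩ < 1 / (2 * (D.ell : ℝ)) := by
  unfold stdExponent
  have hl2 : (2 : ℝ) ≤ (D.lstar : ℝ) := by exact_mod_cast D.two_le_lstar
  have hl : (1 : ℝ) < (D.lstar : ℝ) ^ 2 := by nlinarith
  have hr : ((((0 : ℕ) : ℝ) + 1) ^ 2 / (D.lstar : ℝ) ^ 2) < 1 := by
    rw [div_lt_one (by positivity)]; simpa using hl
  calc (1 / (2 * (D.ell : ℝ))) * ((((0 : ℕ) : ℝ) + 1) ^ 2 / (D.lstar : ℝ) ^ 2)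
      < (1 / (2 * (D.ell : ℝ))) * 1 := mul_lt_mul_of_pos_left hr D.baseExponent_pos
    _ = 1 / (2 * (D.ell : ℝ)) := mul_one _

/-- `|q_w|^{ℓ*/(2ℓ)} = ∏_{j=1}^{ℓ*} |q_w|^{1/(2ℓ)}` (the q-side as an `ℓ*`-fold product). [folklore] -/
theorem qFactor_eq_prod {w : D.W} (hw : w ∈ D.Vss) :
    D.qAbs w ^ ((D.lstar : ℝ) / (2 * D.ell)) = ∏ _i : Fin D.lstar, D.qAbs w ^ (1 / (2 * (D.ell : ℝ))) := by
  rw [Fin.prod_const, ← Real.rpow_natCast, ← Real.rpow_mul (D.qAbs_pos w hw).le]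
  congr 1
  ring

/-- **The local step of Thm. 7.3.1, DERIVED from the printed norm values, at every `ρ ∈ (0,1]` and for every `ℓ ≥ 5`**
(termwise `|q_w|^{(1/2ℓ)(j²/ℓ*²)} ≥ |q_w|^{1/2ℓ}` since `0 < |q_w| < 1` and `j²/ℓ*² ≤ 1`, strictly at `j = 1`; product over
`j = 1, …, ℓ*`). Flag (F-a): no "`ℓ ≫ 0`" is needed. [folklore] -/
theorem localThetaEstimateAt_of_standardPointNorms (h : D.StandardPointNorms) {ρ : ℝ} (hρ : ρ ∈ Set.Ioc (0 : ℝ) 1) :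
    D.LocalThetaEstimateAt ρ := by
  intro w hw
  have hq0 := D.qAbs_pos w hw
  have hq1 := D.qAbs_lt_one w hw
  rw [D.qFactor_eq_prod hw]
  unfold localSize
  refine Finset.prod_lt_prod (fun i _ => Real.rpow_pos_of_pos hq0 _) (fun i _ => ?_)
    ⟨⟨0, lt_of_lt_of_le (by norm_num) D.two_le_lstar⟩, Finset.mem_univ _, ?_⟩
  · rw [h w hw ρ hρ i]
    exact Real.rpow_le_rpow_of_exponent_ge hq0 hq1.le (D.stdExponent_le i)
  · rw [h w hw ρ hρ]
    exact Real.rpow_lt_rpow_of_exponent_gt hq0 hq1 D.stdExponent_zero_lt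

/-- The local step at every `ρ ∈ (0,1]`, as the proof uses it. [folklore] -/
theorem localThetaEstimate_of_standardPointNorms (h : D.StandardPointNorms) : D.LocalThetaEstimate :=
  fun _ hρ => D.localThetaEstimateAt_of_standardPointNorms h hρ

/-- **Thm. 7.3.1 from the printed norm values at the standard point** (composition with
`fundamentalEstimateBL_of_localThetaEstimate`): over `StandardPointNorms` the fundamental theta-values estimate for
`Θ̃^{B_{L′}}_Joshi` is a kernel theorem for every `ℓ ≥ 5`. [folklore] -/
theorem fundamentalEstimateBL_of_standardPointNorms (h : D.StandardPointNorms) : D.FundamentalEstimateBL :=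
  D.fundamentalEstimateBL_of_localThetaEstimate (D.localThetaEstimate_of_standardPointNorms h)

/-- The size of the distinguished element under the printed norm values, in closed product form:
`|Ξ^α_{0,z_Θ}|_{B_{L′},ρ} = ∏_{w∈𝕍^{odd,ss}} ∏_{j=1}^{ℓ*} |q_w|^{(1/2ℓ)(j²/ℓ*²)}` ([J-III] p.56 l.62–77 "by passage to the product").
[folklore] -/
theorem adelicSize_std_of_standardPointNorms (h : D.StandardPointNorms) {ρ : ℝ} (hρ : ρ ∈ Set.Ioc (0 : ℝ) 1) :
    D.adelicSize ρ (D.Xi D.std) = ∏ w ∈ D.Vss, ∏ i : Fin D.lstar, D.qAbs w ^ D.stdExponent i := by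
  rw [D.adelicSize_Xi_eq_prod]
  refine Finset.prod_congr rfl fun w hw => ?_
  unfold localSize
  exact Finset.prod_congr rfl fun i _ => h w hw ρ hρ i

end AdelicThetaDatum

end Summit.ABC.IUTFork.Joshi.ATS3

end
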